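import Literature.NumberTheory.LFunctions.WeightedBProcess
import Literature.NumberTheory.LFunctions.TransverseStationarySum
import HarnessLib

/-!
# Pieces of a two-dimensional exponential sum: the `B`-process along parallel lattice lines followed by
# the transverse bound

Topic `Literature/NumberTheory/LFunctions`.  Everything here is PROVED; the definitions are the hypothesis
structure `VdC.PieceHyp` (extending `VdC.TransverseHyp` by the third line-derivative of the phase, the
line-derivatives of the weight and a bound for the first derivative) and the explicit error `VdC.lineErr`.

For a compact convex `T ⊂ ℂ`, lattice lines `ℓ_b = {ad + be}`, a phase `F` and a weight `φ` as in
`TransverseStationarySum.lean`, we bound the piece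

  `S = ∑_{b₁ ≤ b ≤ b₂} ∑_{a ∈ ℤ} φ(ad + be) e(F(ad + be))`

(all lines meeting `T` having `b₁ ≤ b ≤ b₂`) by

  `‖S‖ ≤ (b₂ - b₁ + 1) · lineErr + ‖𝔣‖ · (transverse bound of norm_transverse_sum_le)`     (`VdC.PieceHyp.norm_piece_le`):

along each line the weighted `B`-process `VdC.WeightedBHyp.weightedBProcess` (its hypotheses are assembled in
`PieceHyp.weightedBHyp`; the continuity of the summand is AUTOMATIC, `VdC.continuous_mul_e_of_Icc`), whose main
terms are `𝔣 ∑_ν A(b,ν) e(q(b,ν))` (`TransverseHyp.mainTerm_eq`), the frequency ranges being enlarged to a common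
range `N = [-⌈ν_m⌉, ⌈ν_m⌉]` (`|F_d| ≤ ν_m`) at no cost (`ampl_eq_zero_of_not_between`); then the sums over `b`
and `ν` are exchanged and `TransverseHyp.norm_transverse_sum_le` is applied.

## References

* E. C. Titchmarsh, *The lattice-points in a circle*, Proc. London Math. Soc. (2) 38 (1935), 96–115.
  [Titchmarsh1935Lattice]
* E. Krätzel, *Lattice Points*, Kluwer 1988, §2.2. [Kratzel1988]
* S. W. Graham, G. Kolesnik, *Van der Corput's Method of Exponential Sums*, LMS LN 126 (1991), §6. [GrahamKolesnik1991]
-/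

noncomputable section

open Finset Real Set Metric Classical

namespace Literature.NumberTheory.LFunctions
namespace VdC

open Literature.Analysis.Fourier

local notation "𝔣C" => _root_.Literature.Analysis.Fourier.fresnelC

/-! ### Continuity of the summand is automatic -/

/-- If `g` and `p` are differentiable at every point of `[α, β]` and `g = 0` off `(α, β)` then
`x ↦ g(x) e(p(x))` is continuous on `ℝ`. [folklore] -/
theorem continuous_mul_e_of_Icc {g p g' p' : ℝ → ℝ} {α β : ℝ}
    (hg : ∀ x ∈ Icc α β, HasDerivAt g (g' x) x) (hp : ∀ x ∈ Icc α β, HasDerivAt p (p' x) x)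
    (hg0 : ∀ x, x ∉ Ioo α β → g x = 0) : Continuous fun x => (g x : ℂ) * e (p x) := by
  refine continuous_iff_continuousAt.2 fun x => ?_
  by_cases hx : x ∈ Icc α β
  · have h1 : ContinuousAt g x := (hg x hx).continuousAt
    have h2 : ContinuousAt p x := (hp x hx).continuousAt
    have hce : Continuous e := by unfold e; fun_prop
    exact (Complex.continuous_ofReal.continuousAt.comp h1).mul (hce.continuousAt.comp h2)
  · -- locally zero
    have hopen : IsOpen (Icc α β)ᶜ := isClosed_Icc.isOpen_compl
    have hev : (fun y => ((g y : ℂ)) * e (p y)) =ᶠ[nhds x] fun _ => 0 := by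
      filter_upwards [hopen.mem_nhds hx] with y hy
      rw [hg0 y (fun h => hy (Ioo_subset_Icc_self h)), Complex.ofReal_zero, zero_mul]
    exact (continuousAt_const.congr hev.symm)

/-! ### The hypotheses of a piece -/

/-- Hypotheses for a piece: `TransverseHyp` together with the third derivative `F_ddd` of the phase along the
lines (`|F_ddd| ≤ λ₃`, continuous along chords), a bound `|F_d| ≤ ν_m` on `T`, and two derivatives `φ_d, φ_dd`
of the weight along the lines (`|φ_d| ≤ G₁`, `|φ_dd| ≤ G₂`, `φ_dd` continuous along chords). [folklore] -/
structure PieceHyp (T : Set ℂ) (d e : ℂ) (F Fd Fe Fdd Fde Fee Fddd : ℂ → ℝ) (φ φd φdd : ℂ → ℝ)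
    (r A Λ₂ Λ₃ κ₁ κ₂ L₂ G Lφ δ₀ lam3 G₁ G₂ νm : ℝ) : Prop
    extends TransverseHyp T d e F Fd Fe Fdd Fde Fee φ r A Λ₂ Λ₃ κ₁ κ₂ L₂ G Lφ δ₀ where
  line3 : ∀ (c a : ℝ), (a : ℂ) * d + (c : ℂ) * e ∈ T →
    HasDerivAt (fun a : ℝ => Fdd ((a : ℂ) * d + (c : ℂ) * e)) (Fddd ((a : ℂ) * d + (c : ℂ) * e)) a
  cont3 : ∀ c : ℝ, ContinuousOn (fun a : ℝ => Fddd ((a : ℂ) * d + (c : ℂ) * e)) {a : ℝ | (a : ℂ) * d + (c : ℂ) * e ∈ T}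
  hFddd : ∀ z ∈ T, |Fddd z| ≤ lam3
  hFd : ∀ z ∈ T, |Fd z| ≤ νm
  lineφ1 : ∀ (c a : ℝ), (a : ℂ) * d + (c : ℂ) * e ∈ T →
    HasDerivAt (fun a : ℝ => φ ((a : ℂ) * d + (c : ℂ) * e)) (φd ((a : ℂ) * d + (c : ℂ) * e)) a
  lineφ2 : ∀ (c a : ℝ), (a : ℂ) * d + (c : ℂ) * e ∈ T →
    HasDerivAt (fun a : ℝ => φd ((a : ℂ) * d + (c : ℂ) * e)) (φdd ((a : ℂ) * d + (c : ℂ) * e)) a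
  contφ2 : ∀ c : ℝ, ContinuousOn (fun a : ℝ => φdd ((a : ℂ) * d + (c : ℂ) * e)) {a : ℝ | (a : ℂ) * d + (c : ℂ) * e ∈ T}
  hφd : ∀ z ∈ T, |φd z| ≤ G₁
  hφdd : ∀ z ∈ T, |φdd z| ≤ G₂

/-- The error of the `B`-process on one line of chord length `≤ ℓ` (the bound of `weightedBProcess` with
`β - α` replaced by `ℓ`). [folklore] -/
def lineErr (ℓ r A lam3 G G₁ G₂ : ℝ) : ℝ :=
  (A * r * ℓ + 1) *
      (G * (2 * A ^ 3 * (2 * π * lam3 / (2 * π * r) ^ 2) * (2 + 2 * Real.log (1 + ℓ * Real.sqrt (2 * π * r))))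
        + G₁ / (2 * π * r) * (10 + 4 * A * Real.log (1 + ℓ * Real.sqrt (2 * π * r))))
    + 2 * (G₁ / (2 * π * r) * (3 + (1 + A) * Real.log (1 + ℓ * Real.sqrt (2 * π * r))))
    + 4 * bTail 0 ℓ r A lam3 G G₁ G₂ (2 * π)

/-- Monotonicity of the `B`-process error in the chord length. [folklore] -/
theorem weightedB_bound_le_lineErr {α β ℓ r A lam3 G G₁ G₂ : ℝ} (hαβ : α ≤ β) (hℓ : β - α ≤ ℓ)
    (hr : 0 < r) (hA : 1 ≤ A) (hlam3 : 0 ≤ lam3) (hG : 0 ≤ G) (hG₁ : 0 ≤ G₁) (hG₂ : 0 ≤ G₂) :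
    (A * r * (β - α) + 1) *
          (G * (2 * A ^ 3 * (2 * π * lam3 / (2 * π * r) ^ 2) * (2 + 2 * Real.log (1 + (β - α) * Real.sqrt (2 * π * r))))
            + G₁ / (2 * π * r) * (10 + 4 * A * Real.log (1 + (β - α) * Real.sqrt (2 * π * r))))
        + 2 * (G₁ / (2 * π * r) * (3 + (1 + A) * Real.log (1 + (β - α) * Real.sqrt (2 * π * r))))
        + 4 * bTail α β r A lam3 G G₁ G₂ (2 * π)
      ≤ lineErr ℓ r A lam3 G G₁ G₂ := by
  have hπ := Real.pi_pos
  have hA0 : 0 ≤ A := by linarith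
  have hba : 0 ≤ β - α := by linarith
  have hsq : 0 ≤ Real.sqrt (2 * π * r) := Real.sqrt_nonneg _
  have hL : Real.log (1 + (β - α) * Real.sqrt (2 * π * r)) ≤ Real.log (1 + ℓ * Real.sqrt (2 * π * r)) := by
    refine Real.log_le_log (by positivity) ?_
    have := mul_le_mul_of_nonneg_right hℓ hsq
    linarith
  have hL0 : 0 ≤ Real.log (1 + (β - α) * Real.sqrt (2 * π * r)) := Real.log_nonneg (by nlinarith)
  have hT : bTail α β r A lam3 G G₁ G₂ (2 * π) ≤ bTail 0 ℓ r A lam3 G G₁ G₂ (2 * π) := by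
    unfold bTail
    rw [sub_zero]
    have hc : 0 ≤ G₂ / (2 * π) ^ 2 + 3 * G₁ * (2 * π * A * r) / (2 * π) ^ 3 + G * (2 * π * lam3) / (2 * π) ^ 3
        + 3 * G * (2 * π * A * r) ^ 2 / (2 * π) ^ 4 := by positivity
    have := mul_le_mul_of_nonneg_right hℓ hc
    linarith
  unfold lineErr
  have h1 : A * r * (β - α) + 1 ≤ A * r * ℓ + 1 := by nlinarith [mul_pos (lt_of_lt_of_le one_pos hA) hr]
  have hE₁ : G * (2 * A ^ 3 * (2 * π * lam3 / (2 * π * r) ^ 2) * (2 + 2 * Real.log (1 + (β - α) * Real.sqrt (2 * π * r))))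
        + G₁ / (2 * π * r) * (10 + 4 * A * Real.log (1 + (β - α) * Real.sqrt (2 * π * r)))
      ≤ G * (2 * A ^ 3 * (2 * π * lam3 / (2 * π * r) ^ 2) * (2 + 2 * Real.log (1 + ℓ * Real.sqrt (2 * π * r))))
        + G₁ / (2 * π * r) * (10 + 4 * A * Real.log (1 + ℓ * Real.sqrt (2 * π * r))) := by
    gcongr
  have hE₁0 : 0 ≤ G * (2 * A ^ 3 * (2 * π * lam3 / (2 * π * r) ^ 2) * (2 + 2 * Real.log (1 + (β - α) * Real.sqrt (2 * π * r))))
        + G₁ / (2 * π * r) * (10 + 4 * A * Real.log (1 + (β - α) * Real.sqrt (2 * π * r))) := by positivity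
  have hE₂ : G₁ / (2 * π * r) * (3 + (1 + A) * Real.log (1 + (β - α) * Real.sqrt (2 * π * r)))
      ≤ G₁ / (2 * π * r) * (3 + (1 + A) * Real.log (1 + ℓ * Real.sqrt (2 * π * r))) := by gcongr
  have hℓ0 : 0 ≤ ℓ := hba.trans hℓ
  have := mul_le_mul h1 hE₁ hE₁0 (by positivity)
  linarith

/-- `lineErr ≥ 0`. [folklore] -/
theorem lineErr_nonneg {ℓ r A lam3 G G₁ G₂ : ℝ} (hℓ : 0 ≤ ℓ) (hr : 0 < r) (hA : 1 ≤ A) (hlam3 : 0 ≤ lam3)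
    (hG : 0 ≤ G) (hG₁ : 0 ≤ G₁) (hG₂ : 0 ≤ G₂) : 0 ≤ lineErr ℓ r A lam3 G G₁ G₂ := by
  have hπ := Real.pi_pos
  have hA0 : 0 ≤ A := by linarith
  have hL0 : 0 ≤ Real.log (1 + ℓ * Real.sqrt (2 * π * r)) :=
    Real.log_nonneg (by nlinarith [Real.sqrt_nonneg (2 * π * r)])
  have hT : 0 ≤ bTail 0 ℓ r A lam3 G G₁ G₂ (2 * π) := by unfold bTail; rw [sub_zero]; positivity
  unfold lineErr
  positivity

namespace PieceHyp

variable {T : Set ℂ} {d e : ℂ} {F Fd Fe Fdd Fde Fee Fddd : ℂ → ℝ} {φ φd φdd : ℂ → ℝ}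
  {r A Λ₂ Λ₃ κ₁ κ₂ L₂ G Lφ δ₀ lam3 G₁ G₂ νm : ℝ}
  (P : PieceHyp T d e F Fd Fe Fdd Fde Fee Fddd φ φd φdd r A Λ₂ Λ₃ κ₁ κ₂ L₂ G Lφ δ₀ lam3 G₁ G₂ νm)
include P

/-- The underlying `TransverseHyp`. [folklore] -/
theorem H : TransverseHyp T d e F Fd Fe Fdd Fde Fee φ r A Λ₂ Λ₃ κ₁ κ₂ L₂ G Lφ δ₀ := P.toTransverseHyp

/-- `δ₀ > 0`. [folklore] -/
theorem δ₀_pos : 0 < δ₀ := by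
  have h := P.hδ₀
  have : 0 ≤ ‖e‖ + (Λ₂ / r + 2) * ‖d‖ := by
    have := P.H.sM_nonneg; positivity
  linarith

/-- The weight vanishes off `T`. [folklore] -/
theorem φ_eq_zero_of_not_mem {z : ℂ} (hz : z ∉ T) : φ z = 0 :=
  P.hφ0 z (by rw [Metric.infDist_zero_of_mem (mem_compl hz)]; exact P.δ₀_pos)

/-- `λ₃ ≥ 0`, `G₁ ≥ 0`, `G₂ ≥ 0`, `ν_m ≥ 0` as soon as `T` is nonempty. [folklore] -/
theorem consts_nonneg {z : ℂ} (hz : z ∈ T) : 0 ≤ lam3 ∧ 0 ≤ G₁ ∧ 0 ≤ G₂ ∧ 0 ≤ νm :=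
  ⟨(abs_nonneg _).trans (P.hFddd z hz), (abs_nonneg _).trans (P.hφd z hz), (abs_nonneg _).trans (P.hφdd z hz),
    (abs_nonneg _).trans (P.hFd z hz)⟩

/-- The weight vanishes along a line outside the open chord `(lo, hi)`. [folklore] -/
theorem φ_line_eq_zero {c x : ℝ} (hne : (P.H.chord c).Nonempty) (hx : x ∉ Ioo (P.H.lo c) (P.H.hi c)) :
    φ ((x : ℂ) * d + (c : ℂ) * e) = 0 := by
  by_cases hxc : x ∈ P.H.chord c
  · -- an end-point
    rw [P.H.chord_eq hne, Set.mem_Icc] at hxc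
    have hends := P.H.infDist_endpoint_eq_zero c
    rcases eq_or_lt_of_le hxc.1 with h | h
    · refine P.hφ0 _ ?_
      rw [show ((x : ℂ) * d + (c : ℂ) * e) = P.H.pt (P.H.lo c) c by rw [← h]; rfl, hends.1]
      exact P.δ₀_pos
    · rcases eq_or_lt_of_le hxc.2 with h' | h'
      · refine P.hφ0 _ ?_
        rw [show ((x : ℂ) * d + (c : ℂ) * e) = P.H.pt (P.H.hi c) c by rw [h']; rfl, hends.2]
        exact P.δ₀_pos
      · exact absurd ⟨h, h'⟩ hx
  · exact P.φ_eq_zero_of_not_mem hxc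

/-- **The hypotheses of the weighted `B`-process along a line** with a non-degenerate chord. [folklore] -/
theorem weightedBHyp {c : ℝ} (hne : (P.H.chord c).Nonempty) (hlt : P.H.lo c < P.H.hi c) :
    WeightedBHyp (fun a : ℝ => φ ((a : ℂ) * d + (c : ℂ) * e)) (fun a : ℝ => φd ((a : ℂ) * d + (c : ℂ) * e))
      (fun a : ℝ => φdd ((a : ℂ) * d + (c : ℂ) * e))
      (fun a : ℝ => F ((a : ℂ) * d + (c : ℂ) * e)) (fun a : ℝ => Fd ((a : ℂ) * d + (c : ℂ) * e))
      (fun a : ℝ => Fdd ((a : ℂ) * d + (c : ℂ) * e)) (fun a : ℝ => Fddd ((a : ℂ) * d + (c : ℂ) * e))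
      (P.H.lo c) (P.H.hi c) r A lam3 G G₁ G₂ := by
  have hch : ∀ x, x ∈ Icc (P.H.lo c) (P.H.hi c) → (x : ℂ) * d + (c : ℂ) * e ∈ T := by
    intro x hx
    have : x ∈ P.H.chord c := by rw [P.H.chord_eq hne]; exact hx
    exact this
  have hIcc : {a : ℝ | (a : ℂ) * d + (c : ℂ) * e ∈ T} = Icc (P.H.lo c) (P.H.hi c) := P.H.chord_eq hne
  refine
    { hαβ := hlt
      hr := P.hr
      hA := P.hA
      hp := fun x hx => P.line1 c x (hch x hx)
      hp' := fun x hx => P.line2 c x (hch x hx)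
      hp'' := fun x hx => P.line3 c x (hch x hx)
      hp'''c := by rw [← hIcc]; exact P.cont3 c
      h2 := fun x hx => P.hFdd _ (hch x hx)
      h3 := fun x hx => P.hFddd _ (hch x hx)
      hg := fun x hx => P.lineφ1 c x (hch x hx)
      hg' := fun x hx => P.lineφ2 c x (hch x hx)
      hg''c := by rw [← hIcc]; exact P.contφ2 c
      hGb := fun x hx => P.hφG _ (hch x hx)
      hG1b := fun x hx => P.hφd _ (hch x hx)
      hG2b := fun x hx => P.hφdd _ (hch x hx)
      hg0 := fun x hx => P.φ_line_eq_zero hne hx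
      hcont := ?_ }
  exact continuous_mul_e_of_Icc (fun x hx => P.lineφ1 c x (hch x hx)) (fun x hx => P.line1 c x (hch x hx))
    (fun x hx => P.φ_line_eq_zero hne hx)

/-- The common frequency range `N = [-⌈ν_m⌉, ⌈ν_m⌉]`. [folklore] -/
def freqs (_P : PieceHyp T d e F Fd Fe Fdd Fde Fee Fddd φ φd φdd r A Λ₂ Λ₃ κ₁ κ₂ L₂ G Lφ δ₀ lam3 G₁ G₂ νm) :
    Finset ℤ := Finset.Icc (-⌈νm⌉) ⌈νm⌉

/-- `#N ≤ 2ν_m + 3`. [folklore] -/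
theorem card_freqs_le {z : ℂ} (hz : z ∈ T) : (P.freqs.card : ℝ) ≤ 2 * νm + 3 := by
  have hν := (P.consts_nonneg hz).2.2.2
  have h1 : (P.freqs.card : ℤ) = ⌈νm⌉ + 1 - -⌈νm⌉ := by
    rw [freqs, Int.card_Icc, Int.toNat_of_nonneg]
    have := Int.ceil_nonneg hν; omega
  have h2 : (P.freqs.card : ℝ) = 2 * (⌈νm⌉ : ℝ) + 1 := by
    have : (P.freqs.card : ℤ) = 2 * ⌈νm⌉ + 1 := by rw [h1]; ring
    exact_mod_cast this
  rw [h2]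
  have := Int.ceil_lt_add_one νm
  linarith

/-- **One line**: `‖∑_a φ e(F) - 𝔣 ∑_{ν ∈ N} A(c,ν) e(q(c,ν))‖ ≤ lineErr ℓ` for every integer... (indeed real) line
index `c` whose chord has length `≤ ℓ`. [folklore] -/
theorem norm_line_sub_main_le (c : ℝ) {ℓ : ℝ} (hℓ0 : 0 ≤ ℓ)
    (hℓ : (P.H.chord c).Nonempty → P.H.hi c - P.H.lo c ≤ ℓ) {z₀ : ℂ} (hz₀ : z₀ ∈ T) :
    ‖(∑' a : ℤ, (φ ((a : ℂ) * d + (c : ℂ) * e) : ℂ) * VdC.e (F ((a : ℂ) * d + (c : ℂ) * e)))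
        - 𝔣C * ∑ ν ∈ P.freqs, (P.H.ampl c ν : ℂ) * VdC.e (P.H.critVal c ν)‖
      ≤ lineErr ℓ r A lam3 G G₁ G₂ := by
  obtain ⟨hlam3, hG₁, hG₂, hνm⟩ := P.consts_nonneg hz₀
  have hErr0 : 0 ≤ lineErr ℓ r A lam3 G G₁ G₂ := lineErr_nonneg hℓ0 P.hr P.hA hlam3 P.hG hG₁ hG₂
  by_cases hne : (P.H.chord c).Nonempty
  swap
  · -- empty chord: everything vanishes
    have h1 : ∀ a : ℤ, (φ ((a : ℂ) * d + (c : ℂ) * e) : ℂ) * VdC.e (F ((a : ℂ) * d + (c : ℂ) * e)) = 0 := by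
      intro a
      have : ((a : ℝ) : ℂ) * d + (c : ℂ) * e ∉ T := fun h => hne ⟨a, h⟩
      rw [show ((a : ℤ) : ℂ) = ((a : ℝ) : ℂ) by push_cast; ring, P.φ_eq_zero_of_not_mem this]
      simp
    have h2 : ∀ ν : ℤ, P.H.ampl c ν = 0 := fun ν =>
      P.H.ampl_eq_zero_of_not fun hCI => hne ((P.H.critInt_iff c ν).1 hCI).choose_spec.1
    simp only [h1, tsum_zero, h2, Complex.ofReal_zero, zero_mul, Finset.sum_const_zero, mul_zero, sub_zero,
      norm_zero]
    exact hErr0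
  rcases eq_or_lt_of_le (P.H.lo_le_hi hne) with heq | hlt
  · -- degenerate chord
    have h1 : ∀ a : ℤ, (φ ((a : ℂ) * d + (c : ℂ) * e) : ℂ) * VdC.e (F ((a : ℂ) * d + (c : ℂ) * e)) = 0 := by
      intro a
      have : ((a : ℝ)) ∉ Ioo (P.H.lo c) (P.H.hi c) := by rw [heq]; simp
      rw [show ((a : ℤ) : ℂ) = ((a : ℝ) : ℂ) by push_cast; ring, P.φ_line_eq_zero hne this]
      simp
    have h2 : ∀ ν : ℤ, P.H.ampl c ν = 0 := fun ν =>
      P.H.ampl_eq_zero_of_not fun hCI => by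
        obtain ⟨x, -, hx, -⟩ := (P.H.critInt_iff c ν).1 hCI
        rw [heq] at hx; simp at hx
    simp only [h1, tsum_zero, h2, Complex.ofReal_zero, zero_mul, Finset.sum_const_zero, mul_zero, sub_zero,
      norm_zero]
    exact hErr0
  -- the generic line
  have W := P.weightedBHyp hne hlt
  have hmain := W.weightedBProcess (fun ν => P.H.critX c ν) (fun ν h1 h2 => P.H.critX_data hne h1 h2)
  -- rewrite the main terms
  have hMT : ∑ ν ∈ Finset.Ioo ⌊Fd ((P.H.lo c : ℂ) * d + (c : ℂ) * e)⌋ ⌈Fd ((P.H.hi c : ℂ) * d + (c : ℂ) * e)⌉,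
        (φ ((P.H.critX c ν : ℂ) * d + (c : ℂ) * e) : ℂ)
          * VdC.e (F ((P.H.critX c ν : ℂ) * d + (c : ℂ) * e) - ν * P.H.critX c ν)
          * ((Real.sqrt (2 * π * Fdd ((P.H.critX c ν : ℂ) * d + (c : ℂ) * e)))⁻¹ : ℝ)
      = ∑ ν ∈ P.freqs, (P.H.ampl c ν : ℂ) * VdC.e (P.H.critVal c ν) := by
    have hsub : Finset.Ioo ⌊Fd ((P.H.lo c : ℂ) * d + (c : ℂ) * e)⌋ ⌈Fd ((P.H.hi c : ℂ) * d + (c : ℂ) * e)⌉ ⊆ P.freqs := by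
      intro ν hν
      rw [Finset.mem_Ioo, Int.floor_lt, Int.lt_ceil] at hν
      have hlo := P.hFd _ (P.H.lo_mem hne)
      have hhi := P.hFd _ (P.H.hi_mem hne)
      rw [abs_le] at hlo hhi
      rw [freqs, Finset.mem_Icc]
      constructor
      · have : (-⌈νm⌉ : ℤ) ≤ ν := by
          have h1 : ((-⌈νm⌉ : ℤ) : ℝ) ≤ -νm := by push_cast; linarith [Int.le_ceil νm]
          have h2 : (-νm : ℝ) < ν := by
            have := hν.1; change Fd (P.H.pt (P.H.lo c) c) < ν at this; linarith
          exact_mod_cast (h1.trans_lt h2).le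
        exact this
      · have h2 : (ν : ℝ) < Fd (P.H.pt (P.H.hi c) c) := hν.2
        have : (ν : ℝ) ≤ ⌈νm⌉ := by linarith [Int.le_ceil νm]
        exact_mod_cast this
    rw [← Finset.sum_subset hsub]
    · refine Finset.sum_congr rfl fun ν hν => ?_
      rw [Finset.mem_Ioo, Int.floor_lt, Int.lt_ceil] at hν
      exact P.H.mainTerm_eq hne hν.1 hν.2
    · intro ν _ hν
      rw [Finset.mem_Ioo, Int.floor_lt, Int.lt_ceil, not_and_or, not_lt, not_lt] at hν
      have : P.H.ampl c ν = 0 := by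
        refine P.H.ampl_eq_zero_of_not_between fun h => ?_
        rcases hν with h' | h'
        · exact absurd h.1 (not_lt.2 h')
        · exact absurd h.2 (not_lt.2 h')
      rw [this, Complex.ofReal_zero, zero_mul]
  rw [hMT] at hmain
  refine hmain.trans ?_
  exact weightedB_bound_le_lineErr (P.H.lo_le_hi hne) (hℓ hne) P.hr P.hA hlam3 P.hG hG₁ hG₂

/-- **The piece bound.**  If every line meeting `T` has index in `[b₁, b₂]` and chord length `≤ ℓ`, then
`‖∑_{b₁ ≤ b ≤ b₂} ∑_a φ(ad+be) e(F(ad+be))‖ ≤ (b₂ - b₁ + 1) lineErr ℓ + ‖𝔣‖ · #N δ_A L (12(hL√μ + 1/√μ) + 1)`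
(notation of `norm_transverse_sum_le`, `#N ≤ 2ν_m + 3`). [cite: Titchmarsh1935Lattice] [cite: Kratzel1988, §2.2] -/
theorem norm_piece_le {b₁ b₂ : ℤ} (hb : b₁ ≤ b₂)
    (hrange : ∀ b : ℤ, (P.H.chord b).Nonempty → b₁ ≤ b ∧ b ≤ b₂) {ℓ : ℝ} (hℓ0 : 0 ≤ ℓ)
    (hℓ : ∀ b : ℤ, (P.H.chord b).Nonempty → P.H.hi b - P.H.lo b ≤ ℓ) {z₀ : ℂ} (hz₀ : z₀ ∈ T) :
    ‖∑ b ∈ Finset.Icc b₁ b₂, ∑' a : ℤ, (φ ((a : ℂ) * d + (b : ℂ) * e) : ℂ) * VdC.e (F ((a : ℂ) * d + (b : ℂ) * e))‖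
      ≤ ((b₂ : ℝ) - b₁ + 1) * lineErr ℓ r A lam3 G G₁ G₂
        + ‖𝔣C‖ * ((2 * νm + 3) * ((‖e‖ + (Λ₂ / r + 1) * ‖d‖) *
            (Lφ / Real.sqrt (2 * π * r) + π * G * L₂ / ((2 * π * r) * Real.sqrt (2 * π * r)))
          * ((b₂ : ℝ) - b₁ + 1) *
          (12 * ((κ₂ + κ₁ / 2) / (κ₁ / 2) * ((b₂ : ℝ) - b₁ + 1) * Real.sqrt (κ₁ / 2) + 1 / Real.sqrt (κ₁ / 2)) + 1))) := by
  set S : ℤ → ℂ := fun b => ∑' a : ℤ, (φ ((a : ℂ) * d + (b : ℂ) * e) : ℂ) * VdC.e (F ((a : ℂ) * d + (b : ℂ) * e))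
    with hS
  set M : ℤ → ℂ := fun b => ∑ ν ∈ P.freqs, (P.H.ampl b ν : ℂ) * VdC.e (P.H.critVal b ν) with hM
  have hline : ∀ b : ℤ, ‖S b - 𝔣C * M b‖ ≤ lineErr ℓ r A lam3 G G₁ G₂ := fun b => by
    have := P.norm_line_sub_main_le (b : ℝ) hℓ0 (hℓ b) hz₀
    simpa [hS, hM] using this
  have hdecomp : ∑ b ∈ Finset.Icc b₁ b₂, S b
      = ∑ b ∈ Finset.Icc b₁ b₂, (S b - 𝔣C * M b) + 𝔣C * ∑ b ∈ Finset.Icc b₁ b₂, M b := by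
    rw [Finset.mul_sum, ← Finset.sum_add_distrib]
    refine Finset.sum_congr rfl fun b _ => by ring
  have hcard : ((Finset.Icc b₁ b₂).card : ℝ) = (b₂ : ℝ) - b₁ + 1 := by
    have : ((Finset.Icc b₁ b₂).card : ℤ) = b₂ + 1 - b₁ := by
      rw [Int.card_Icc, Int.toNat_of_nonneg]; omega
    have h' : ((Finset.Icc b₁ b₂).card : ℝ) = ((b₂ + 1 - b₁ : ℤ) : ℝ) := by exact_mod_cast this
    rw [h']; push_cast; ring
  -- the transverse bound
  have hT := P.H.norm_transverse_sum_le hb hrange P.freqs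
  have hswap : ∑ b ∈ Finset.Icc b₁ b₂, M b
      = ∑ ν ∈ P.freqs, ∑ b ∈ Finset.Icc b₁ b₂, (P.H.ampl b ν : ℂ) * VdC.e (P.H.critVal b ν) := by
    rw [hM]; exact Finset.sum_comm
  have hN := P.card_freqs_le hz₀
  have hX0 : 0 ≤ ((‖e‖ + (Λ₂ / r + 1) * ‖d‖) *
            (Lφ / Real.sqrt (2 * π * r) + π * G * L₂ / ((2 * π * r) * Real.sqrt (2 * π * r)))
          * ((b₂ : ℝ) - b₁ + 1) *
          (12 * ((κ₂ + κ₁ / 2) / (κ₁ / 2) * ((b₂ : ℝ) - b₁ + 1) * Real.sqrt (κ₁ / 2) + 1 / Real.sqrt (κ₁ / 2)) + 1)) := by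
    have := P.H.sM_nonneg; have := P.hLφ; have := P.hG; have := P.hL₂; have := P.hr; have := P.hκ₁
    have : (0 : ℝ) ≤ (b₂ : ℝ) - b₁ + 1 := by
      have : (b₁ : ℝ) ≤ b₂ := by exact_mod_cast hb
      linarith
    have : 0 ≤ κ₂ + κ₁ / 2 := by linarith [P.hκ₁₂]
    positivity
  calc ‖∑ b ∈ Finset.Icc b₁ b₂, S b‖
      = ‖∑ b ∈ Finset.Icc b₁ b₂, (S b - 𝔣C * M b) + 𝔣C * ∑ b ∈ Finset.Icc b₁ b₂, M b‖ := by rw [hdecomp]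
    _ ≤ ‖∑ b ∈ Finset.Icc b₁ b₂, (S b - 𝔣C * M b)‖ + ‖𝔣C * ∑ b ∈ Finset.Icc b₁ b₂, M b‖ := norm_add_le _ _
    _ ≤ ∑ b ∈ Finset.Icc b₁ b₂, ‖S b - 𝔣C * M b‖ + ‖𝔣C‖ * ‖∑ b ∈ Finset.Icc b₁ b₂, M b‖ := by
        rw [norm_mul]; exact add_le_add (norm_sum_le _ _) le_rfl
    _ ≤ ∑ b ∈ Finset.Icc b₁ b₂, lineErr ℓ r A lam3 G G₁ G₂ + ‖𝔣C‖ * ‖∑ b ∈ Finset.Icc b₁ b₂, M b‖ :=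
        add_le_add (Finset.sum_le_sum fun b _ => hline b) le_rfl
    _ ≤ _ := by
        rw [Finset.sum_const, nsmul_eq_mul, hcard, hswap]
        refine add_le_add le_rfl (mul_le_mul_of_nonneg_left (hT.trans ?_) (norm_nonneg _))
        exact mul_le_mul_of_nonneg_right hN hX0 |>.trans_eq' (by ring) |>.trans_eq (by ring)

end PieceHyp

/-! ### Geometry of the lines: index range and chord lengths inside a ball -/

namespace TransverseHyp

variable {T : Set ℂ} {d e : ℂ} {F Fd Fe Fdd Fde Fee : ℂ → ℝ} {φ : ℂ → ℝ}
  {r A Λ₂ Λ₃ κ₁ κ₂ L₂ G Lφ δ₀ : ℝ}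
  (H : TransverseHyp T d e F Fd Fe Fdd Fde Fee φ r A Λ₂ Λ₃ κ₁ κ₂ L₂ G Lφ δ₀)
include H

/-- If `T ⊆ B(0, ϱ)` then every chord has length `≤ 2ϱ/‖d‖`. [folklore] -/
theorem hi_sub_lo_le {ϱ : ℝ} (hT : T ⊆ closedBall (0 : ℂ) ϱ) {c : ℝ} (hne : (H.chord c).Nonempty) :
    H.hi c - H.lo c ≤ 2 * ϱ / ‖d‖ := by
  have hd : 0 < ‖d‖ := norm_pos_iff.2 H.d_ne
  have h1 := hT (H.lo_mem hne)
  have h2 := hT (H.hi_mem hne)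
  rw [mem_closedBall, dist_zero_right] at h1 h2
  have h3 := H.norm_pt_sub_pt (H.hi c) (H.lo c) c
  rw [abs_of_nonneg (by linarith [H.lo_le_hi hne])] at h3
  have h4 : ‖H.pt (H.hi c) c - H.pt (H.lo c) c‖ ≤ 2 * ϱ := (norm_sub_le _ _).trans (by
    change ‖((H.hi c : ℝ) : ℂ) * d + (c : ℂ) * e‖ + ‖((H.lo c : ℝ) : ℂ) * d + (c : ℂ) * e‖ ≤ 2 * ϱ
    linarith [h1, h2])
  rw [le_div_iff₀ hd]
  linarith

/-- If `T ⊆ B(0, ϱ)` then a line `ℓ_c` meeting `T` has `|c| · |Im(e d̄)| ≤ ϱ ‖d‖`. [folklore] -/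
theorem abs_index_le {ϱ : ℝ} (hT : T ⊆ closedBall (0 : ℂ) ϱ) {c : ℝ} (hne : (H.chord c).Nonempty) :
    |c| * |(e * (starRingEnd ℂ) d).im| ≤ ϱ * ‖d‖ := by
  obtain ⟨a, ha⟩ := hne
  have h1 := hT ha
  rw [mem_closedBall, dist_zero_right] at h1
  have hid : (((a : ℂ) * d + (c : ℂ) * e) * (starRingEnd ℂ) d).im = c * (e * (starRingEnd ℂ) d).im := by
    have hdd : (d * (starRingEnd ℂ) d).im = 0 := by rw [Complex.mul_conj]; norm_cast
    rw [add_mul, Complex.add_im, mul_assoc, mul_assoc, Complex.im_ofReal_mul, Complex.im_ofReal_mul, hdd,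
      mul_zero, zero_add]
  have h2 : |(((a : ℂ) * d + (c : ℂ) * e) * (starRingEnd ℂ) d).im| ≤ ‖(a : ℂ) * d + (c : ℂ) * e‖ * ‖d‖ := by
    refine (Complex.abs_im_le_norm _).trans ?_
    rw [norm_mul, Complex.norm_conj]
  rw [hid, abs_mul] at h2
  exact h2.trans (mul_le_mul_of_nonneg_right h1 (norm_nonneg _))

end TransverseHyp

end VdC
end Literature.NumberTheory.LFunctions

end
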